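import Literature.NumberTheory.Sieve.SmoothSharpMinorArcsLemmas
import Literature.NumberTheory.Sieve.SmoothSharpMinorArcsTools
import Literature.NumberTheory.Sieve.SmoothParityAsymptotic
import HarnessLib

/-!
# Minor arcs for sharp box-masked friable exponential sums with a dilation (polylog regime)

Topic `Literature/NumberTheory/Sieve`; a PROVED file ([Harper2016, §5, Proposition 5], packaged for the
circle method with friable variables in SHARP BOXES).  In the polylog regime `y = ⌊(log x)^{100000}⌋` of the
master scale `x`, for every box `S(X,y) ∖ S(X',y)` with `x/(log x)^B ≤ X' ≤ X ≤ x`, optionally restricted to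
a parity class (`m ∈ {1, 2}`), every dilation `d ≥ 1`, every denominator bound `4d(log x)^B ≤ R ≤ x^{1/10}`
(a POWER of `x` is allowed — the point of this file) and every `θ` off the master major arcs
`𝔐(R) = ⋃_{q ≤ R} ⋃_{a} {|θ − a/q| ≤ R/x}`:

`|∑_{n ∈ S(X,y)∖S(X',y), n ≡ c (m)} e(n d θ)| ≤ C (log x)^{28} (d (log x)^B/R)^{49/100} 𝓟(X)`,

`𝓟(X) = X^{α(X,y)} ζ(α(X,y),y)/√φ₂(α(X,y),y)` the saddle size at the box's upper scale
(`SharpMinor.norm_boxExpSum_filter_le_of_minor`; `SharpMinor.norm_boxExpSum_le_of_minor` is the unmasked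
case).  With `R = x^{1/100}` the saving `(d(log x)^B/R)^{49/100}` is a power of `x`; the junk term
`y² x^{9/10}` of the pointwise bound and the change of saddle sizes between the scales `X, X', X/2, X'/2`
are absorbed (`SmoothSharpMinorArcsTools.lean`).  The explicit (untied) forms and the transport of the
minor-arc property through the dilation are in `SmoothSharpMinorArcsLemmas.lean`.

## References

* A. J. Harper, *Minor arcs, mean values, and restriction theory for exponential sums over smooth numbers*,
  Compositio Math. 152 (2016) 1121–1158, §5, Proposition 5 [Harper2016].
-/

noncomputable section

open Finset Filter Real
open scoped FourierTransform

namespace Literature.NumberTheory.Sieve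

namespace SharpMinor

/-! ### The eventual packaging -/

set_option maxHeartbeats 1600000 in
-- a long assembly with a large context
/-- **Minor arcs for sharp friable boxes with a parity mask and a dilation (polylog regime).**  For every
`B`, there is `C` such that for all large `x`, with `L = log x`, `y = ⌊L^{100000}⌋` and
`𝓟(Z) = Z^{α(Z,y)} ζ(α(Z,y),y)/√φ₂(α(Z,y),y)`: for all box scales `x/L^B ≤ X' ≤ X ≤ x`, dilations `d ≥ 1`,
denominator bounds `4dL^B ≤ R ≤ x^{1/10}`, every `θ` off the master major arcs (`|θ − a/q| > R/x` for all
`1 ≤ q ≤ R`, `a ∈ ℤ`) and every modulus `m ∈ {1, 2}` and class `c`,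
`|∑_{n ∈ S(X,y)∖S(X',y), n ≡ c (m)} e(n d θ)| ≤ C L^{28} (dL^B/R)^{49/100} 𝓟(X)`.
Proof: the class is all of the box, its even part `2·(S(X/2)∖S(X'/2))` (frequency `2dθ`), or the
difference; each box is bounded by `norm_boxExpSum_le_explicit` (regime facts at the real scales
`X, X', X/2, X'/2 ∈ [√x, x]` from `polylog_regime_real_scales`), the auxiliary saddle sizes are `≤ C₂ 𝓟(X)`
(`saddleSize_real_le`), `y^{1/4000} ≤ L^{25}`, and the junk `82(1+L)²y²x^{9/10}` is `≤ L^{28}(dL^B/R)^{49/100}𝓟(X)`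
because `𝓟(X) ≥ Ψ(X,y)/√(3L²) ≥ x^{39999/40000}/(2L^{B+1})` while `(dL^B/R)^{49/100} ≥ x^{−1/20}`.
[cite: Harper2016, §5, Proposition 5] -/
theorem norm_boxExpSum_filter_le_of_minor (B : ℕ) :
    ∃ C : ℝ, 0 < C ∧ ∀ᶠ x : ℝ in atTop, ∀ (X X' : ℝ), x / Real.log x ^ B ≤ X' → X' ≤ X → X ≤ x →
      ∀ d : ℕ, 1 ≤ d → ∀ R : ℝ, 4 * (d : ℝ) * Real.log x ^ B ≤ R → R ≤ x ^ (1 / 10 : ℝ) →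
      ∀ θ : ℝ, (∀ q : ℕ, 1 ≤ q → (q : ℝ) ≤ R → ∀ a : ℤ, R / x < |θ - a / q|) →
      ∀ m c : ℕ, (m = 1 ∨ m = 2) →
        ‖∑ n ∈ (Nat.smoothNumbersUpTo ⌊X⌋₊ (⌊Real.log x ^ 100000⌋₊ + 1) \
              Nat.smoothNumbersUpTo ⌊X'⌋₊ (⌊Real.log x ^ 100000⌋₊ + 1)).filter (fun n => n ≡ c [MOD m]),
            (𝐞 ((n : ℝ) * ((d : ℝ) * θ)) : ℂ)‖ ≤
          C * Real.log x ^ 28 * ((d : ℝ) * Real.log x ^ B / R) ^ (49 / 100 : ℝ) *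
            (X ^ saddlePoint X ⌊Real.log x ^ 100000⌋₊ *
              (smoothZeta (saddlePoint X ⌊Real.log x ^ 100000⌋₊) ⌊Real.log x ^ 100000⌋₊ /
                Real.sqrt (saddlePhi₂ (saddlePoint X ⌊Real.log x ^ 100000⌋₊) ⌊Real.log x ^ 100000⌋₊))) := by
  classical
  obtain ⟨C₁, x₁, hC₁, hbox⟩ := norm_boxExpSum_le_explicit
  obtain ⟨C₂, x₂, hC₂, hcmp⟩ := saddleSize_real_le
  obtain ⟨x₃, hlow⟩ := card_le_sqrt_mul_saddleSize
  refine ⟨C₁ + 5 * C₁ * C₂ + 2, by positivity, ?_⟩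
  filter_upwards [polylog_regime_real_scales (max (max x₁ x₂) (max x₃ (Real.exp 1))), polylog_regime_basic,
    SmoothArcs.eventually_log_pow_le_mul_rpow B (s := 1 / 2) (c := 1 / 2) (by norm_num) (by norm_num),
    SmoothArcs.eventually_log_pow_le_mul_rpow (200002 + B) (s := (1999 : ℝ) / 40000) (c := 1 / 656) (by norm_num)
      (by norm_num)] with x hreg hbasic hE₁ hE₃ X X' hX' hX'X hXx d hd R hR hRx θ hminor m c hm
  obtain ⟨hx1, hL2, hy2, -, hyK, -, -, -, -, hy200, hsqx⟩ := hbasic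
  set L : ℝ := Real.log x with hL
  set y : ℕ := ⌊L ^ 100000⌋₊ with hy
  have hx0 : 0 < x := by linarith
  have hL1 : 1 ≤ L := by linarith
  have hL0 : 0 < L := by linarith
  have hLB : 1 ≤ L ^ B := one_le_pow₀ hL1
  have hLB0 : 0 < L ^ B := by positivity
  have hd1 : (1 : ℝ) ≤ d := by exact_mod_cast hd
  have hR0 : 0 < R := lt_of_lt_of_le (by positivity) hR
  have hy2r : (2 : ℝ) ≤ y := by exact_mod_cast hy2
  have hy1r : (1 : ℝ) ≤ y := by linarith
  have hy0r : (0 : ℝ) ≤ y := by linarith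
  -- the scales are at least `√x`
  have hsx0 : 0 < x ^ (1 / 2 : ℝ) := by positivity
  have hxx : x ^ (1 / 2 : ℝ) * x ^ (1 / 2 : ℝ) = x := by rw [← Real.rpow_add hx0]; norm_num
  have hE₁' : x ^ (1 / 2 : ℝ) ≤ x / L ^ B / 2 := by
    rw [le_div_iff₀ (by norm_num : (0 : ℝ) < 2), le_div_iff₀ hLB0]
    calc x ^ (1 / 2 : ℝ) * 2 * L ^ B ≤ x ^ (1 / 2 : ℝ) * 2 * (1 / 2 * x ^ (1 / 2 : ℝ)) := by gcongr
      _ = x ^ (1 / 2 : ℝ) * x ^ (1 / 2 : ℝ) := by ring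
      _ = x := hxx
  have hX'2 : x ^ (1 / 2 : ℝ) ≤ X' / 2 := hE₁'.trans (by linarith)
  have hsX' : x ^ (1 / 2 : ℝ) ≤ X' := by linarith
  have hsX : x ^ (1 / 2 : ℝ) ≤ X := by linarith
  have hsX2 : x ^ (1 / 2 : ℝ) ≤ X / 2 := by linarith
  have hX'0 : 0 < X' := by linarith
  have hX0 : 0 < X := by linarith
  -- regime facts at the four scales
  obtain ⟨hzX, h8X, h6X, h200X, hαX, hΨX, -, -⟩ := hreg X hsX hXx
  obtain ⟨hzX', h8X', h6X', h200X', hαX', -, -, -⟩ := hreg X' hsX' (hX'X.trans hXx)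
  obtain ⟨hzX2, h8X2, h6X2, h200X2, hαX2, -, -, -⟩ := hreg (X / 2) hsX2 (by linarith)
  obtain ⟨hzX'2, h8X'2, h6X'2, h200X'2, hαX'2, -, -, -⟩ := hreg (X' / 2) hX'2 (by linarith)
  simp only [max_le_iff] at hzX hzX' hzX2 hzX'2
  -- the parameter `s = dL^B/R ≤ 1/4`
  set s : ℝ := (d : ℝ) * L ^ B / R with hs
  have hs0 : 0 < s := by positivity
  have hsR : s * R = d * L ^ B := by rw [hs]; field_simp
  have hs4 : 4 * s ≤ 1 := by
    have h1 : 4 * s * R ≤ 1 * R := by rw [mul_assoc, hsR, one_mul, ← mul_assoc]; exact hR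
    exact le_of_mul_le_mul_right h1 hR0
  have hs1 : s ≤ 1 := by linarith
  have hdx : (d : ℝ) * x ≤ s * R * X' := by
    rw [hsR]
    have h2 : x ≤ L ^ B * X' := by rw [div_le_iff₀ hLB0] at hX'; linarith
    calc (d : ℝ) * x ≤ d * (L ^ B * X') := by gcongr
      _ = d * L ^ B * X' := by ring
  have hRx5 : R ≤ x ^ (1 / 5 : ℝ) :=
    hRx.trans (Real.rpow_le_rpow_of_exponent_le hx1.le (by norm_num))
  -- the plain box bound and the even box bound (scales `X/2, X'/2`, dilation `2d`, `s' = 4s`)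
  have hb₁ := hbox x X X' s R θ y d hzX'.1.1 hX'X hXx h8X h6X h200X hαX h8X' h6X' h200X' hαX' hd hs0
    hs1 hdx hRx5 hminor
  have hd2 : 1 ≤ 2 * d := by omega
  have hdx2 : ((2 * d : ℕ) : ℝ) * x ≤ 4 * s * R * (X' / 2) := by
    push_cast
    calc 2 * (d : ℝ) * x = 2 * ((d : ℝ) * x) := by ring
      _ ≤ 2 * (s * R * X') := by gcongr
      _ = 4 * s * R * (X' / 2) := by ring
  have hb₂ := hbox x (X / 2) (X' / 2) (4 * s) R θ y (2 * d) hzX'2.1.1 (by linarith) (by linarith) h8X2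
    h6X2 h200X2 hαX2 h8X'2 h6X'2 h200X'2 hαX'2 hd2 (by positivity) hs4 hdx2 hRx5 hminor
  -- the even part of the box sum is the dilated sum at the halved scales
  have heven : ∑ n ∈ (Nat.smoothNumbersUpTo ⌊X⌋₊ (y + 1) \ Nat.smoothNumbersUpTo ⌊X'⌋₊ (y + 1)).filter
      (fun n => n ≡ 0 [MOD 2]), (𝐞 ((n : ℝ) * ((d : ℝ) * θ)) : ℂ) =
      ∑ n ∈ Nat.smoothNumbersUpTo ⌊X / 2⌋₊ (y + 1) \ Nat.smoothNumbersUpTo ⌊X' / 2⌋₊ (y + 1),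
        (𝐞 ((n : ℝ) * (((2 * d : ℕ) : ℝ) * θ)) : ℂ) := by
    rw [sum_sdiff_filter_even_eq hy2]
    refine Finset.sum_congr rfl fun n _ => ?_
    push_cast
    ring_nf
  rw [← heven] at hb₂
  -- the three cases `m = 1`, `m = 2 ∧ c even`, `m = 2 ∧ c odd`
  have hcases :
      ‖∑ n ∈ (Nat.smoothNumbersUpTo ⌊X⌋₊ (y + 1) \ Nat.smoothNumbersUpTo ⌊X'⌋₊ (y + 1)).filter
          (fun n => n ≡ c [MOD m]), (𝐞 ((n : ℝ) * ((d : ℝ) * θ)) : ℂ)‖ ≤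
        ‖∑ n ∈ Nat.smoothNumbersUpTo ⌊X⌋₊ (y + 1) \ Nat.smoothNumbersUpTo ⌊X'⌋₊ (y + 1),
            (𝐞 ((n : ℝ) * ((d : ℝ) * θ)) : ℂ)‖ +
        ‖∑ n ∈ (Nat.smoothNumbersUpTo ⌊X⌋₊ (y + 1) \ Nat.smoothNumbersUpTo ⌊X'⌋₊ (y + 1)).filter
          (fun n => n ≡ 0 [MOD 2]), (𝐞 ((n : ℝ) * ((d : ℝ) * θ)) : ℂ)‖ := by
    rcases hm with rfl | rfl
    · rw [Finset.filter_true_of_mem (fun n _ => Nat.modEq_one)]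
      exact le_add_of_nonneg_right (norm_nonneg _)
    · rcases Nat.mod_two_eq_zero_or_one c with hc | hc
      · have hfc : (Nat.smoothNumbersUpTo ⌊X⌋₊ (y + 1) \ Nat.smoothNumbersUpTo ⌊X'⌋₊ (y + 1)).filter
            (fun n => n ≡ c [MOD 2]) =
            (Nat.smoothNumbersUpTo ⌊X⌋₊ (y + 1) \ Nat.smoothNumbersUpTo ⌊X'⌋₊ (y + 1)).filter
            (fun n => n ≡ 0 [MOD 2]) :=
          Finset.filter_congr fun n _ => by unfold Nat.ModEq; omega
        rw [hfc]
        exact le_add_of_nonneg_left (norm_nonneg _)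
      · have hfc : (Nat.smoothNumbersUpTo ⌊X⌋₊ (y + 1) \ Nat.smoothNumbersUpTo ⌊X'⌋₊ (y + 1)).filter
            (fun n => n ≡ c [MOD 2]) =
            (Nat.smoothNumbersUpTo ⌊X⌋₊ (y + 1) \ Nat.smoothNumbersUpTo ⌊X'⌋₊ (y + 1)).filter
            (fun n => ¬ n ≡ 0 [MOD 2]) :=
          Finset.filter_congr fun n _ => by unfold Nat.ModEq; omega
        rw [hfc, Finset.filter_not, Finset.sum_sdiff_eq_sub (Finset.filter_subset _ _)]
        exact norm_sub_le _ _
  refine hcases.trans ((add_le_add hb₁ hb₂).trans ?_)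
  -- ### the inputs of `combine_aux`
  have hP0 : ∀ Z : ℝ, 0 < Z → 1 - 1 / 10000 ≤ saddlePoint Z y →
      0 ≤ Z ^ saddlePoint Z y * (smoothZeta (saddlePoint Z y) y / Real.sqrt (saddlePhi₂ (saddlePoint Z y) y)) := by
    intro Z hZ hα
    have : 0 < smoothZeta (saddlePoint Z y) y := smoothZeta_pos (by linarith)
    positivity
  -- comparison of the auxiliary saddle sizes with `𝓟(X)`
  obtain ⟨h4X, h5X⟩ := regime_four_fifth hzX.2.2 h8X h6X
  have hXsq : X ^ (1 / 2 : ℝ) ≤ x ^ (1 / 2 : ℝ) := Real.rpow_le_rpow hX0.le hXx (by norm_num)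
  have hXX : X ^ (1 / 2 : ℝ) * X ^ (1 / 2 : ℝ) = X := by rw [← Real.rpow_add hX0]; norm_num
  have hdom : ∀ W : ℝ, x ^ (1 / 2 : ℝ) ≤ W → X ≤ W * X ^ (1 / 2 : ℝ) := by
    intro W hW
    calc X = X ^ (1 / 2 : ℝ) * X ^ (1 / 2 : ℝ) := hXX.symm
      _ ≤ x ^ (1 / 2 : ℝ) * X ^ (1 / 2 : ℝ) := by gcongr
      _ ≤ W * X ^ (1 / 2 : ℝ) := by gcongr
  have h₁ := hcmp X X' y hzX.1.2 h4X h5X hX'0 hX'X (hdom X' hsX')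
  have h₂ := hcmp X (X / 2) y hzX.1.2 h4X h5X (by linarith) (by linarith) (hdom (X / 2) hsX2)
  have h₃ := hcmp X (X' / 2) y hzX.1.2 h4X h5X (by linarith) (by linarith) (hdom (X' / 2) hX'2)
  -- the junk
  have hX1 : 1 ≤ X := by
    have : (1 : ℝ) ≤ Real.exp 1 := by have := Real.add_one_le_exp (1 : ℝ); linarith
    exact this.trans hzX.2.2
  have hyX : (y : ℝ) ≤ X := le_trans (le_self_pow₀ hy1r (by norm_num)) h200X
  have hyx : (y : ℝ) ≤ x := (le_trans (le_self_pow₀ hy1r (by norm_num)) hy200).trans hsqx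
  have hLX1 : 1 ≤ Real.log X := by
    rw [Real.le_log_iff_exp_le hX0]; exact hzX.2.2
  have h3X : Real.log X ^ 3 ≤ y := le_trans (pow_le_pow_right₀ hLX1 (by norm_num)) h8X
  have hΨP := hlow X y hzX.2.1 h3X hyX
  have hJ := junk_le (B := B) hx1.le hL1 hyK hd hs hR0 hRx hs1 hX1 (hX'.trans hX'X) hΨX hΨP
    (Real.log_le_log hX0 hXx) (Real.log_nonneg hy1r) (Real.log_le_log (by linarith) hyx)
    (hP0 X hX0 hαX) (by linarith)
  have hfin := combine_aux (C₂ := C₂) hC₁.le (pow_nonneg hL0.le 3) (Real.rpow_nonneg hy0r _)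
    (Real.rpow_nonneg hs0.le _) (hP0 X hX0 hαX) (hP0 X' hX'0 hαX') (hP0 (X / 2) (by linarith) hαX2)
    (hP0 (X' / 2) (by linarith) hαX'2) (rpow_level_le hy0r hL0.le hyK) (rpow_four_mul_le hs0.le)
    h₁ h₂ h₃ hJ
  refine hfin.trans (le_of_eq ?_)
  rw [← pow_add]

/-- **Minor arcs for sharp friable boxes with a dilation (no parity mask).**  The case `m = 1` of
`norm_boxExpSum_filter_le_of_minor`: for all large `x` (`L = log x`, `y = ⌊L^{100000}⌋`), all
`x/L^B ≤ X' ≤ X ≤ x`, `d ≥ 1`, `4dL^B ≤ R ≤ x^{1/10}` and `θ` off the master major arcs,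
`|∑_{n ∈ S(X,y)∖S(X',y)} e(n d θ)| ≤ C L^{28} (dL^B/R)^{49/100} 𝓟(X)`. [cite: Harper2016, §5, Proposition 5] -/
theorem norm_boxExpSum_le_of_minor (B : ℕ) :
    ∃ C : ℝ, 0 < C ∧ ∀ᶠ x : ℝ in atTop, ∀ (X X' : ℝ), x / Real.log x ^ B ≤ X' → X' ≤ X → X ≤ x →
      ∀ d : ℕ, 1 ≤ d → ∀ R : ℝ, 4 * (d : ℝ) * Real.log x ^ B ≤ R → R ≤ x ^ (1 / 10 : ℝ) →
      ∀ θ : ℝ, (∀ q : ℕ, 1 ≤ q → (q : ℝ) ≤ R → ∀ a : ℤ, R / x < |θ - a / q|) →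
        ‖∑ n ∈ Nat.smoothNumbersUpTo ⌊X⌋₊ (⌊Real.log x ^ 100000⌋₊ + 1) \
              Nat.smoothNumbersUpTo ⌊X'⌋₊ (⌊Real.log x ^ 100000⌋₊ + 1),
            (𝐞 ((n : ℝ) * ((d : ℝ) * θ)) : ℂ)‖ ≤
          C * Real.log x ^ 28 * ((d : ℝ) * Real.log x ^ B / R) ^ (49 / 100 : ℝ) *
            (X ^ saddlePoint X ⌊Real.log x ^ 100000⌋₊ *
              (smoothZeta (saddlePoint X ⌊Real.log x ^ 100000⌋₊) ⌊Real.log x ^ 100000⌋₊ /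
                Real.sqrt (saddlePhi₂ (saddlePoint X ⌊Real.log x ^ 100000⌋₊) ⌊Real.log x ^ 100000⌋₊))) := by
  obtain ⟨C, hC, h⟩ := norm_boxExpSum_filter_le_of_minor B
  refine ⟨C, hC, h.mono fun x hx X X' hX' hX'X hXx d hd R hR hRx θ hminor => ?_⟩
  have key := hx X X' hX' hX'X hXx d hd R hR hRx θ hminor 1 0 (Or.inl rfl)
  rwa [Finset.filter_true_of_mem (fun n _ => Nat.modEq_one)] at key

end SharpMinor

end Literature.NumberTheory.Sieve

end
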